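import Mathlib.MeasureTheory.Integral.Pi
import Mathlib.MeasureTheory.Integral.Prod
import Literature.MathematicalPhysics.QuantumFieldTheory.Balaban1983to89.B16Eq190Resummation

/-!
# `Balaban1983to89.B16Eq191PrintedActivity` — the activity (1.91) of T. Bałaban, *Large field renormalization. II.
Localization, exponentiation, and bounds for the 𝐑 operation*, Commun. Math. Phys. **122** (1989) 355–392
[Balaban1989LargeFieldII] (cell paper B16), p. 388 [PDF 34], WITH ITS PRINTED BODY: the interpolation integrals
`Π_{Y∈𝐃} ∫₀¹ dt(Y)` OUTSIDE the integral operations `Π_h 𝐓′_k(X_{j_h})`, and their exchange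

statement-level skeleton of published theorems with citation tags; proofs where landed; nothing here is a claim about
the Yang–Mills mass gap

PDF held: `paper:balaban1989-cmp122-large-field-ii` (journal page = PDF page + 354); p. 388 re-read this session as an
image (`run/shared/lean/pub/pub-balaban/b2b-balaban-ref1/pages/1989-cmp122-large-field-II/…-p034-x2.png`) and as text
(`lit read paper:balaban1989-cmp122-large-field-ii --pages 34`).

CITATION HEADER / WHAT IS REPRODUCED (mega-formalization `lit-balaban`, B16 owner r13 gen 103; HOME
`run/shared/lean/pub/lit-balaban/`, rows `lit-balaban-r13/ROWS-B16.md`): SKELETON row **B16.Eq1.91**, p. 388, verbatim: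
*"where the activities F(X′) are defined by*
  `F(X′) = Σ_q Σ′_{{X_{j₁},…,X_{j_q}}} Σ′_𝐃 Π_{Y∈𝐃} ∫₀¹dt(Y) Π_{h=1}^q 𝐓′_k(X_{j_h}) Π_{Y∈𝐃} V(Y) exp Σ_{Y∈𝐃} t(Y)V(Y).` (1.91)
*Here the summation is over {X_{j₁},…,X_{j_q}} and 𝐃 such that the connected localization domain they determine is equal
to X′."*  The outer sums and their index condition are the tree's `B16Eq190Resummation.F191` (unit p24, with body); the
SUMMAND there is abstract, and p24's Part D instantiates it by the Mayer step as `mayerTerm Op V φ S 𝐃 =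
Op S [ψ ↦ Π_{Y∈𝐃} ∫₀¹ e^{tV(Y,ψ)} V(Y,ψ) dt] φ` — the interpolation integrals INSIDE the operation `Op S = Π_h 𝐓′_k(X_{j_h})`,
its docstring recording: *"their exchange with the 𝐓′_k-integrals, as print writes them, is not asserted"*.

THIS FILE types the summand AS PRINTED — `mayerTerm191 Op V φ S 𝐃 = ∫_{t ∈ ]0,1]^𝐃} Op S [ψ ↦ Π_{Y∈𝐃} V(Y,ψ) · exp Σ_{Y∈𝐃}
t(Y)V(Y,ψ)] φ dt` (Lebesgue measure on the cube `]0,1]^𝐃`, the operations acting on the t-dependent integrand, the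
t-integrals outside) — and PROVES the exchange:
* `prod_intervalIntegral_eq_integral_tBox`: `Π_{Y∈𝐃} ∫₀¹ e^{t v_Y} v_Y dt = ∫_{]0,1]^𝐃} (Π_Y v_Y) exp(Σ_Y t_Y v_Y) dt` (Fubini
  over the finitely many interpolation parameters, Mathlib `integral_fintype_prod_eq_prod`), so p24's inner function IS
  `ψ ↦ ∫_{]0,1]^𝐃} integrand191 V 𝐃 t ψ dt` (`inner_eq_integral_integrand191`);
* `mayerTerm191_eq_mayerTerm`: the printed summand EQUALS p24's whenever the operation commutes with the t-integral of this
  integrand (`Exchange191`, the exchange property, a hypothesis predicate on the abstract operations);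
* `exchange191_of_integralOps`: the exchange property DERIVED, by Fubini (Mathlib `integral_integral_swap`), for INTEGRAL
  OPERATIONS — `IntegralOps Op μ`: on integrable functions `Op S` is integration against a finite measure `μ S φ` on the
  field configurations (what (1.71) p. 378 displays for `𝐓′_k(X)`: `∫dB↾_X σ(g_kB) δ_{rT}(B) χ′(X) ∫dV_h↾_… χ_{h,1/2}(…) 𝐓_h(…)
  exp[…]`, Gaussian and Haar integrals with characteristic functions) — when the `V(Y)` are measurable and bounded (the
  (1.68)-type bound `|V(Y)| ≤ a(Y)` used in (1.92)); and trivially for p24's evaluation model `resetOp`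
  (`exchange191_resetOp`), which is itself an `IntegralOps` against Dirac measures (`integralOps_resetOp`);
* consequences BY NAME: the activities agree (`F191_mayerTerm191`), the Mayer step and (1.90) for the curly bracket of
  (1.72) with the printed summand (`bracket_eq_sum_mayerTerm191`, `eq190_bracket191`), the selector-free (1.97) bound
  of p24's Part H for the printed activities (`norm_F191_mayerTerm191_le`), and the same for p24's Part I
  configuration-dependent terms `V_{{X_j}}(Y)` (`mayerTermS191`, `mayerTermS191_eq_mayerTermS`,
  `bracketS_eq_sum_mayerTermS191`, `mayerTermS191_eq_mayerTermS_of_integralOps`); for integral operations the exchange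
  hypothesis is DISCHARGED throughout (`mayerTerm191_eq_mayerTerm_of_integralOps`, `eq190_bracket191_of_integralOps`,
  `norm_F191_mayerTerm191_le_of_integralOps`).
NOT reproduced: the construction (1.71) of the operations `𝐓′_k(X)` (abstract `Op`, as in `B16Eq190Resummation`; row
B16.Eq1.71 typed-existing).  No `sorry`, no axiom, no `Prop`-valued fact; hypothesis predicates have bodies and models.
-/

open MeasureTheory

namespace Literature.MathematicalPhysics.QuantumFieldTheory.Balaban1983to89.B16Eq191PrintedActivity

open B16Eq190Resummation
open Literature.Probability.LatticeModels (polymerPartitionFunction)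

noncomputable section

/-! ## §1. The printed summand of (1.91): interpolation integrals outside the operations -/

section Printed

variable {LF DomY Φ : Type*}

/-- The interpolation cube `]0,1]^𝐃` of (1.91) (`Π_{Y∈𝐃} ∫₀¹ dt(Y)`; the tree's interval integral `∫ t in 0..1` is the
integral over `]0,1]`). [cite: Balaban1989LargeFieldII, (1.91) p.388] -/
def tBox (D : Finset DomY) : Set (↥D → ℝ) := Set.univ.pi fun _ => Set.Ioc (0 : ℝ) 1

/-- The function UNDER the operations in (1.91) at the interpolation parameters `t`: `ψ ↦ Π_{Y∈𝐃} V(Y,ψ) · exp Σ_{Y∈𝐃} t(Y)V(Y,ψ)`.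
[cite: Balaban1989LargeFieldII, (1.91) p.388] -/
def integrand191 (V : DomY → Φ → ℂ) (D : Finset DomY) (t : ↥D → ℝ) (ψ : Φ) : ℂ :=
  (∏ Y ∈ D, V Y ψ) * Complex.exp (∑ Y : ↥D, ((t Y : ℝ) : ℂ) * V Y ψ)

/-- **The summand of (1.91) AS PRINTED** for one term `({X_{j_h}}_{h≤q}, 𝐃)`:
`Π_{Y∈𝐃} ∫₀¹dt(Y) Π_{h=1}^q 𝐓′_k(X_{j_h}) Π_{Y∈𝐃} V(Y) exp Σ_{Y∈𝐃} t(Y)V(Y)` — the integral over `t ∈ ]0,1]^𝐃` (Lebesgue) of the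
operation `Op S = Π_h 𝐓′_k(X_{j_h})` applied to `integrand191 V 𝐃 t`, evaluated at the field configuration `φ`.
[cite: Balaban1989LargeFieldII, (1.91) p.388] -/
def mayerTerm191 (Op : Finset LF → (Φ → ℂ) →+ (Φ → ℂ)) (V : DomY → Φ → ℂ) (φ : Φ) (S : Finset LF)
    (D : Finset DomY) : ℂ :=
  ∫ t in tBox D, Op S (integrand191 V D t) φ

/-- Unfolding of the printed summand. [cite: Balaban1989LargeFieldII, (1.91) p.388] -/
theorem mayerTerm191_def (Op : Finset LF → (Φ → ℂ) →+ (Φ → ℂ)) (V : DomY → Φ → ℂ) (φ : Φ) (S : Finset LF)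
    (D : Finset DomY) : mayerTerm191 Op V φ S D = ∫ t in tBox D, Op S (integrand191 V D t) φ := rfl

/-- The interpolation cube is a measurable set. [cite: Balaban1989LargeFieldII, (1.91) p.388] -/
theorem measurableSet_tBox (D : Finset DomY) : MeasurableSet (tBox D) :=
  MeasurableSet.univ_pi fun _ => measurableSet_Ioc

/-- The interpolation cube has Lebesgue measure `1`. [cite: Balaban1989LargeFieldII, (1.91) p.388] -/
theorem volume_tBox (D : Finset DomY) : volume (tBox D) = 1 := by
  rw [tBox, Real.volume_pi_Ioc]
  simp

/-- On the cube every interpolation parameter lies in `]0,1]`. [cite: Balaban1989LargeFieldII, (1.91) p.388] -/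
theorem mem_tBox_iff {D : Finset DomY} {t : ↥D → ℝ} : t ∈ tBox D ↔ ∀ Y, t Y ∈ Set.Ioc (0 : ℝ) 1 := by
  simp [tBox]

/-! ## §2. Fubini over the interpolation parameters: p24's inner function is the t-integral of `integrand191` -/

/-- `Π_{Y∈𝐃} e^{t_Y v_Y} v_Y = (Π_{Y∈𝐃} v_Y) · exp Σ_{Y∈𝐃} t_Y v_Y` (pointwise algebra of the integrand).
[cite: Balaban1989LargeFieldII, (1.91) p.388] -/
theorem prod_exp_mul_eq (D : Finset DomY) (v : DomY → ℂ) (t : ↥D → ℝ) :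
    ∏ Y : ↥D, (Complex.exp (((t Y : ℝ) : ℂ) * v Y) * v Y)
      = (∏ Y ∈ D, v Y) * Complex.exp (∑ Y : ↥D, ((t Y : ℝ) : ℂ) * v Y) := by
  rw [Finset.prod_mul_distrib, Complex.exp_sum, Finset.prod_coe_sort D v, mul_comm]

/-- **Fubini over the interpolation parameters**: `Π_{Y∈𝐃} ∫₀¹ e^{t v_Y} v_Y dt = ∫_{]0,1]^𝐃} (Π_{Y∈𝐃} v_Y) exp(Σ_Y t_Y v_Y) dt`
— the product of the one-dimensional interpolation integrals is the integral over the cube (Mathlib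
`integral_fintype_prod_eq_prod`, `Measure.restrict_pi_pi`). [cite: Balaban1989LargeFieldII, (1.91) p.388] -/
theorem prod_intervalIntegral_eq_integral_tBox (D : Finset DomY) (v : DomY → ℂ) :
    ∏ Y ∈ D, ∫ t in (0 : ℝ)..1, Complex.exp ((t : ℂ) * v Y) * v Y
      = ∫ t in tBox D, (∏ Y ∈ D, v Y) * Complex.exp (∑ Y : ↥D, ((t Y : ℝ) : ℂ) * v Y) := by
  have h1 : ∀ Y : DomY, ∫ t in (0 : ℝ)..1, Complex.exp ((t : ℂ) * v Y) * v Y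
      = ∫ t, Complex.exp ((t : ℂ) * v Y) * v Y ∂(volume.restrict (Set.Ioc (0 : ℝ) 1)) :=
    fun Y => intervalIntegral.integral_of_le zero_le_one
  simp_rw [h1]
  rw [← Finset.prod_coe_sort D]
  rw [← MeasureTheory.integral_fintype_prod_eq_prod
    (fun (Y : ↥D) (t : ℝ) => Complex.exp ((t : ℂ) * v Y) * v Y)]
  rw [← MeasureTheory.Measure.restrict_pi_pi, ← MeasureTheory.volume_pi]
  refine setIntegral_congr_fun (measurableSet_tBox D) fun t _ => ?_
  exact prod_exp_mul_eq D v t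

/-- **p24's inner function IS the t-integral of the printed integrand**: for every field configuration `ψ`,
`Π_{Y∈𝐃} ∫₀¹ e^{tV(Y,ψ)}V(Y,ψ) dt = ∫_{]0,1]^𝐃} integrand191 V 𝐃 t ψ dt`. [cite: Balaban1989LargeFieldII, (1.91) p.388] -/
theorem inner_eq_integral_integrand191 (V : DomY → Φ → ℂ) (D : Finset DomY) :
    (fun ψ => ∏ Y ∈ D, ∫ t in (0 : ℝ)..1, Complex.exp ((t : ℂ) * V Y ψ) * V Y ψ)
      = fun ψ => ∫ t in tBox D, integrand191 V D t ψ := by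
  funext ψ
  exact prod_intervalIntegral_eq_integral_tBox D (fun Y => V Y ψ)

/-- p24's Mayer term rewritten with the t-integral pulled in front of the integrand (still inside the operation).
[cite: Balaban1989LargeFieldII, (1.91) p.388] -/
theorem mayerTerm_eq_op_integral (Op : Finset LF → (Φ → ℂ) →+ (Φ → ℂ)) (V : DomY → Φ → ℂ) (φ : Φ) (S : Finset LF)
    (D : Finset DomY) : mayerTerm Op V φ S D = Op S (fun ψ => ∫ t in tBox D, integrand191 V D t ψ) φ := by
  rw [mayerTerm, inner_eq_integral_integrand191]

/-! ## §3. The exchange property and the identification with p24's Mayer term -/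

/-- **The exchange property** for the term `(S, 𝐃)` at `φ`: the operation `Op S = Π_h 𝐓′_k(X_{j_h})` commutes with the
interpolation integral over `]0,1]^𝐃` of the (1.91) integrand — `Op S [ψ ↦ ∫ integrand dt] φ = ∫ Op S [integrand(t)] φ dt`.
A hypothesis predicate on the abstract operations; DERIVED below for integral operations (`exchange191_of_integralOps`)
and for the evaluation model (`exchange191_resetOp`). [cite: Balaban1989LargeFieldII, (1.91) p.388] -/
def Exchange191 (Op : Finset LF → (Φ → ℂ) →+ (Φ → ℂ)) (V : DomY → Φ → ℂ) (φ : Φ) (S : Finset LF)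
    (D : Finset DomY) : Prop :=
  Op S (fun ψ => ∫ t in tBox D, integrand191 V D t ψ) φ = ∫ t in tBox D, Op S (integrand191 V D t) φ

/-- **(1.91)'s printed summand = p24's Mayer term** under the exchange property.
[cite: Balaban1989LargeFieldII, (1.91) p.388] -/
theorem mayerTerm191_eq_mayerTerm {Op : Finset LF → (Φ → ℂ) →+ (Φ → ℂ)} {V : DomY → Φ → ℂ} {φ : Φ}
    {S : Finset LF} {D : Finset DomY} (h : Exchange191 Op V φ S D) :
    mayerTerm191 Op V φ S D = mayerTerm Op V φ S D := by
  rw [mayerTerm_eq_op_integral, mayerTerm191]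
  exact h.symm

/-- The two term functionals coincide when every term has the exchange property.
[cite: Balaban1989LargeFieldII, (1.91) p.388] -/
theorem mayerTerm191_eq {Op : Finset LF → (Φ → ℂ) →+ (Φ → ℂ)} {V : DomY → Φ → ℂ} {φ : Φ}
    (h : ∀ S D, Exchange191 Op V φ S D) : mayerTerm191 Op V φ = mayerTerm Op V φ := by
  funext S D
  exact mayerTerm191_eq_mayerTerm (h S D)

/-- **The Mayer step with the printed summand**: the curly bracket of (1.72) equals `Σ_{{X_j}} Σ_𝐃 mayerTerm191({X_j}, 𝐃)`
(p24's `bracket_eq_sum_mayerTerm` + the exchange). [cite: Balaban1989LargeFieldII, (1.90) p.388] -/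
theorem bracket_eq_sum_mayerTerm191 [Fintype LF] [Fintype DomY] (Op : Finset LF → (Φ → ℂ) →+ (Φ → ℂ))
    (V : DomY → Φ → ℂ) (φ : Φ) (h : ∀ S D, Exchange191 Op V φ S D) :
    bracket Op V φ = ∑ S : Finset LF, ∑ D : Finset DomY, mayerTerm191 Op V φ S D := by
  rw [bracket_eq_sum_mayerTerm, mayerTerm191_eq h]

/-- **The printed summand for CONFIGURATION-DEPENDENT localization terms** `V_{{X_j}}(Y)` (p24's Part I, `mayerTermS`): the
same body at the family's own terms `V S`. [cite: Balaban1989LargeFieldII, (1.91) p.388] -/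
def mayerTermS191 (Op : Finset LF → (Φ → ℂ) →+ (Φ → ℂ)) (V : Finset LF → DomY → Φ → ℂ) (φ : Φ) (S : Finset LF)
    (D : Finset DomY) : ℂ :=
  mayerTerm191 Op (V S) φ S D

/-- `mayerTermS191` is `mayerTerm191` at the family's own localization terms (definitional).
[cite: Balaban1989LargeFieldII, (1.91) p.388] -/
theorem mayerTermS191_eq (Op : Finset LF → (Φ → ℂ) →+ (Φ → ℂ)) (V : Finset LF → DomY → Φ → ℂ) (φ : Φ)
    (S : Finset LF) (D : Finset DomY) : mayerTermS191 Op V φ S D = mayerTerm191 Op (V S) φ S D := rfl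

/-- The configuration-dependent printed summand = p24's `mayerTermS` under the exchange property for the family's terms.
[cite: Balaban1989LargeFieldII, (1.91) p.388] -/
theorem mayerTermS191_eq_mayerTermS {Op : Finset LF → (Φ → ℂ) →+ (Φ → ℂ)} {V : Finset LF → DomY → Φ → ℂ} {φ : Φ}
    {S : Finset LF} {D : Finset DomY} (h : Exchange191 Op (V S) φ S D) :
    mayerTermS191 Op V φ S D = mayerTermS Op V φ S D := by
  rw [mayerTermS191_eq, mayerTermS_eq]
  exact mayerTerm191_eq_mayerTerm h

/-- The two configuration-dependent term functionals coincide when every term has the exchange property.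
[cite: Balaban1989LargeFieldII, (1.91) p.388] -/
theorem mayerTermS191_eq_mayerTermS_fun {Op : Finset LF → (Φ → ℂ) →+ (Φ → ℂ)} {V : Finset LF → DomY → Φ → ℂ}
    {φ : Φ} (h : ∀ S D, Exchange191 Op (V S) φ S D) : mayerTermS191 Op V φ = mayerTermS Op V φ := by
  funext S D
  exact mayerTermS191_eq_mayerTermS (h S D)

/-- **The Mayer step for the configuration-dependent bracket with the printed summand** (p24's
`bracketS_eq_sum_mayerTermS` + the exchange). [cite: Balaban1989LargeFieldII, (1.90) p.388] -/
theorem bracketS_eq_sum_mayerTermS191 [Fintype LF] [Fintype DomY] (Op : Finset LF → (Φ → ℂ) →+ (Φ → ℂ))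
    (V : Finset LF → DomY → Φ → ℂ) (φ : Φ) (h : ∀ S D, Exchange191 Op (V S) φ S D) :
    bracketS Op V φ = ∑ S : Finset LF, ∑ D : Finset DomY, mayerTermS191 Op V φ S D := by
  rw [bracketS_eq_sum_mayerTermS, mayerTermS191_eq_mayerTermS_fun h]

variable {Cube : Type*} [DecidableEq Cube] {adjC : Cube → Cube → Prop} {locX : LF → Finset Cube}
  {locY : DomY → Finset Cube} {Yfix : Finset Cube}

/-- **The activities (1.91) with the printed summand are p24's activities** (`F191` of the two term functionals agree).
[cite: Balaban1989LargeFieldII, (1.91) p.388] -/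
theorem F191_mayerTerm191 [Fintype LF] [Fintype DomY] [DecidableEq LF] [DecidableEq DomY]
    {Op : Finset LF → (Φ → ℂ) →+ (Φ → ℂ)} {V : DomY → Φ → ℂ} {φ : Φ} (h : ∀ S D, Exchange191 Op V φ S D)
    (X : Finset Cube) :
    F191 adjC locX locY Yfix (mayerTerm191 Op V φ) X = F191 adjC locX locY Yfix (mayerTerm Op V φ) X := by
  rw [mayerTerm191_eq h]

/-- **(1.90) for the curly bracket of (1.72) with the activities (1.91) AS PRINTED**: p24's `eq190_bracket` with the
summand `mayerTerm191` (interpolation integrals outside the operations), under the exchange property and the hypotheses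
of `eq190_bracket` (factorization `TermMul` of the printed terms, empty family = identity, outside cubes, reflexive and
symmetric adjacency). [cite: Balaban1989LargeFieldII, (1.90) p.388] -/
theorem eq190_bracket191 [Fintype LF] [Fintype DomY] [DecidableEq LF] [DecidableEq DomY] [DecidableRel adjC]
    (hrefl : ∀ a, adjC a a) (hsymm : ∀ a b, adjC a b → adjC b a) (houtX : ∀ j, (locX j \ Yfix).Nonempty)
    (houtY : ∀ Y, (locY Y \ Yfix).Nonempty) (Op : Finset LF → (Φ → ℂ) →+ (Φ → ℂ)) (V : DomY → Φ → ℂ) (φ : Φ)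
    (hOp0 : ∀ f, Op ∅ f = f) (h : ∀ S D, Exchange191 Op V φ S D)
    (hmul : TermMul adjC locX locY Yfix (mayerTerm191 Op V φ)) :
    bracket Op V φ = polymerPartitionFunction (pinc adjC Yfix) (F191 adjC locX locY Yfix (mayerTerm191 Op V φ))
      (polys190 adjC locX locY Yfix) := by
  have hmul' : TermMul adjC locX locY Yfix (mayerTerm Op V φ) := by rwa [mayerTerm191_eq h] at hmul
  rw [mayerTerm191_eq h]
  exact eq190_bracket hrefl hsymm houtX houtY Op V φ hOp0 hmul'

/-- **(1.97), selector-free, for the activities (1.91) AS PRINTED**: p24's `norm_F191_mayerTerm_le` transported along the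
exchange. [cite: Balaban1989LargeFieldII, (1.97) p.389] -/
theorem norm_F191_mayerTerm191_le [Fintype LF] [Fintype DomY] [DecidableEq LF] [DecidableEq DomY]
    (sz : Sizes LF DomY Cube) (K : B16Ineq197.Consts) (hK : K.Small)
    {Op : Finset LF → (Φ → ℂ) →+ (Φ → ℂ)} {θ : LF → ℝ} (hOp : OpBound Op θ) (hθ : ∀ j, 0 ≤ θ j ∧ θ j ≤ K.θ)
    {V : DomY → Φ → ℂ} (h168 : ∀ Y ψ, ‖V Y ψ‖ ≤ K.a (sz.dY Y)) (φ : Φ) (h : ∀ S D, Exchange191 Op V φ S D)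
    {X : Finset Cube}
    (h193s : (polymer191 adjC locX locY Yfix sz X).Subadd193 K)
    (h193v : (polymer191 adjC locX locY Yfix sz X).Vol193 K)
    (hXB : (polymer191 adjC locX locY Yfix sz X).XBudget K)
    (h194 : (polymer191 adjC locX locY Yfix sz X).Anch194 K)
    (h196 : (polymer191 adjC locX locY Yfix sz X).Count196 K) :
    ‖F191 adjC locX locY Yfix (mayerTerm191 Op V φ) X‖
      ≤ (Real.exp (-K.p0) + K.α ^ (1 / 3 : ℝ)) * Real.exp (-((1 + K.β) * K.κ) * sz.dX X) := by
  rw [F191_mayerTerm191 h]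
  exact norm_F191_mayerTerm_le sz K hK hOp hθ h168 φ h193s h193v hXB h194 h196

end Printed

/-! ## §4. Integral operations: the exchange property by Fubini -/

section Integral

variable {LF DomY Φ : Type*}

variable [MeasurableSpace Φ]

/-- **Integral operations** — the content of (1.71) p. 378 used here: each `Op S = Π_h 𝐓′_k(X_{j_h})` acts on integrable
functions of the field configuration as integration against a finite measure `μ S φ` (the `dB`-, `dV_h`-integrals of (1.71)
with their characteristic functions and densities, depending on the outer configuration `φ`).  A hypothesis structure on
the abstract operations; non-vacuous (`integralOps_resetOp`). [cite: Balaban1989LargeFieldII, (1.71) p.378] -/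
structure IntegralOps (Op : Finset LF → (Φ → ℂ) →+ (Φ → ℂ)) (μ : Finset LF → Φ → Measure Φ) : Prop where
  /-- the kernels are finite measures -/
  isFiniteMeasure : ∀ S φ, IsFiniteMeasure (μ S φ)
  /-- on integrable functions the operation is integration against the kernel -/
  apply_eq : ∀ S φ (f : Φ → ℂ), Integrable f (μ S φ) → Op S f φ = ∫ ψ, f ψ ∂(μ S φ)

/-- The (1.91) integrand is jointly measurable in the interpolation parameters and the field configuration when the
`V(Y)` are measurable. [cite: Balaban1989LargeFieldII, (1.91) p.388] -/
theorem measurable_integrand191 {V : DomY → Φ → ℂ} {D : Finset DomY} (hVm : ∀ Y ∈ D, Measurable (V Y)) :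
    Measurable (fun p : (↥D → ℝ) × Φ => integrand191 V D p.1 p.2) := by
  unfold integrand191
  refine Measurable.mul ?_ (Complex.measurable_exp.comp ?_)
  · exact Finset.measurable_prod D fun Y hY => (hVm Y hY).comp measurable_snd
  · refine Finset.measurable_sum Finset.univ fun Y _ => ?_
    exact (Complex.measurable_ofReal.comp ((measurable_pi_apply Y).comp measurable_fst)).mul
      ((hVm Y Y.2).comp measurable_snd)

/-- The (1.91) integrand at fixed interpolation parameters is measurable in the field configuration.
[cite: Balaban1989LargeFieldII, (1.91) p.388] -/
theorem measurable_integrand191_left {V : DomY → Φ → ℂ} {D : Finset DomY} (hVm : ∀ Y ∈ D, Measurable (V Y))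
    (t : ↥D → ℝ) : Measurable (integrand191 V D t) :=
  (measurable_integrand191 hVm).comp (measurable_const.prodMk measurable_id)

omit [MeasurableSpace Φ] in
/-- Bound of the (1.91) integrand at arbitrary interpolation parameters: `‖Π V · exp Σ tV‖ ≤ Π a · exp Σ |t| a` when
`|V(Y)| ≤ a(Y)`. [cite: Balaban1989LargeFieldII, (1.92) p.388] -/
theorem norm_integrand191_le {V : DomY → Φ → ℂ} {D : Finset DomY} {a : DomY → ℝ}
    (hVb : ∀ Y ∈ D, ∀ ψ, ‖V Y ψ‖ ≤ a Y) (t : ↥D → ℝ) (ψ : Φ) :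
    ‖integrand191 V D t ψ‖ ≤ (∏ Y ∈ D, a Y) * Real.exp (∑ Y : ↥D, |t Y| * a Y) := by
  unfold integrand191
  rw [norm_mul, norm_prod, Complex.norm_exp]
  refine mul_le_mul (Finset.prod_le_prod (fun Y _ => norm_nonneg _) fun Y hY => hVb Y hY ψ)
    (Real.exp_le_exp.2 ?_) (Real.exp_pos _).le (Finset.prod_nonneg fun Y hY => (norm_nonneg _).trans (hVb Y hY ψ))
  rw [Complex.re_sum]
  refine Finset.sum_le_sum fun Y _ => ?_
  calc (((t Y : ℝ) : ℂ) * V Y ψ).re ≤ ‖((t Y : ℝ) : ℂ) * V Y ψ‖ := Complex.re_le_norm _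
    _ = |t Y| * ‖V Y ψ‖ := by rw [norm_mul, Complex.norm_real, Real.norm_eq_abs]
    _ ≤ |t Y| * a Y := mul_le_mul_of_nonneg_left (hVb Y Y.2 ψ) (abs_nonneg _)

omit [MeasurableSpace Φ] in
/-- Bound of the (1.91) integrand ON THE CUBE: `‖integrand‖ ≤ Π_{Y∈𝐃} a(Y) · exp Σ_{Y∈𝐃} a(Y)` — the two (1.92) factors.
[cite: Balaban1989LargeFieldII, (1.92) p.388] -/
theorem norm_integrand191_le_of_mem {V : DomY → Φ → ℂ} {D : Finset DomY} {a : DomY → ℝ}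
    (hVb : ∀ Y ∈ D, ∀ ψ, ‖V Y ψ‖ ≤ a Y) {t : ↥D → ℝ} (ht : t ∈ tBox D) (ψ : Φ) :
    ‖integrand191 V D t ψ‖ ≤ (∏ Y ∈ D, a Y) * Real.exp (∑ Y ∈ D, a Y) := by
  refine (norm_integrand191_le hVb t ψ).trans (mul_le_mul_of_nonneg_left (Real.exp_le_exp.2 ?_)
    (Finset.prod_nonneg fun Y hY => (norm_nonneg _).trans (hVb Y hY ψ)))
  rw [← Finset.sum_coe_sort D a]
  refine Finset.sum_le_sum fun Y _ => ?_
  have hY := mem_tBox_iff.1 ht Y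
  have ha : 0 ≤ a Y := (norm_nonneg _).trans (hVb Y Y.2 ψ)
  have : |t Y| ≤ 1 := by
    rw [abs_le]
    constructor <;> linarith [hY.1, hY.2]
  calc |t Y| * a Y ≤ 1 * a Y := mul_le_mul_of_nonneg_right this ha
    _ = a Y := one_mul _

/-- **The exchange property for integral operations, by Fubini**: if `Op` are integral operations (`IntegralOps Op μ`)
and the `V(Y)`, `Y ∈ 𝐃`, are measurable and bounded, then `Op S` commutes with the interpolation integrals of (1.91)
(Mathlib `integral_integral_swap` on `]0,1]^𝐃 × Φ`, the integrand bounded and jointly measurable, both measures finite).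
[cite: Balaban1989LargeFieldII, (1.91) p.388] -/
theorem exchange191_of_integralOps {Op : Finset LF → (Φ → ℂ) →+ (Φ → ℂ)} {μ : Finset LF → Φ → Measure Φ}
    (hOp : IntegralOps Op μ) {V : DomY → Φ → ℂ} {D : Finset DomY} {a : DomY → ℝ}
    (hVm : ∀ Y ∈ D, Measurable (V Y)) (hVb : ∀ Y ∈ D, ∀ ψ, ‖V Y ψ‖ ≤ a Y) (φ : Φ) (S : Finset LF) :
    Exchange191 Op V φ S D := by
  haveI : IsFiniteMeasure (μ S φ) := hOp.isFiniteMeasure S φ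
  set ν : Measure (↥D → ℝ) := volume.restrict (tBox D) with hν
  haveI : IsFiniteMeasure ν := by
    refine ⟨?_⟩
    rw [hν, Measure.restrict_apply_univ, volume_tBox]
    exact ENNReal.one_lt_top
  have hG : Measurable (fun p : (↥D → ℝ) × Φ => integrand191 V D p.1 p.2) := measurable_integrand191 hVm
  -- each slice is integrable against the kernel
  have hint_t : ∀ t, Integrable (integrand191 V D t) (μ S φ) := fun t =>
    Integrable.of_bound (measurable_integrand191_left hVm t).aestronglyMeasurable _
      (ae_of_all _ fun ψ => norm_integrand191_le hVb t ψ)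
  -- the integrand is integrable on the product `]0,1]^𝐃 × Φ`
  have hbox : ∀ᵐ p ∂(ν.prod (μ S φ)), p.1 ∈ tBox D := by
    have h1 : ∀ᵐ t ∂ν, t ∈ tBox D := ae_restrict_mem (measurableSet_tBox D)
    exact (Measure.quasiMeasurePreserving_fst (μ := ν) (ν := μ S φ)).ae h1
  have hprod : Integrable (Function.uncurry fun t ψ => integrand191 V D t ψ) (ν.prod (μ S φ)) := by
    refine Integrable.of_bound hG.aestronglyMeasurable ((∏ Y ∈ D, a Y) * Real.exp (∑ Y ∈ D, a Y)) ?_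
    filter_upwards [hbox] with p hp
    exact norm_integrand191_le_of_mem hVb hp p.2
  have hinner : Integrable (fun ψ => ∫ t, integrand191 V D t ψ ∂ν) (μ S φ) := hprod.integral_prod_right
  unfold Exchange191
  rw [hOp.apply_eq S φ _ hinner]
  rw [← integral_integral_swap hprod]
  refine integral_congr_ae (ae_of_all _ fun t => ?_)
  exact (hOp.apply_eq S φ _ (hint_t t)).symm

/-- **(1.91) AS PRINTED = p24's Mayer term for integral operations** with measurable bounded `V(Y)`.
[cite: Balaban1989LargeFieldII, (1.91) p.388] -/
theorem mayerTerm191_eq_mayerTerm_of_integralOps {Op : Finset LF → (Φ → ℂ) →+ (Φ → ℂ)}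
    {μ : Finset LF → Φ → Measure Φ} (hOp : IntegralOps Op μ) {V : DomY → Φ → ℂ} {a : DomY → ℝ}
    (hVm : ∀ Y, Measurable (V Y)) (hVb : ∀ Y ψ, ‖V Y ψ‖ ≤ a Y) (φ : Φ) :
    mayerTerm191 Op V φ = mayerTerm Op V φ :=
  mayerTerm191_eq fun S _ => exchange191_of_integralOps hOp (fun Y _ => hVm Y) (fun Y _ ψ => hVb Y ψ) φ S

/-- The configuration-dependent version for integral operations. [cite: Balaban1989LargeFieldII, (1.91) p.388] -/
theorem mayerTermS191_eq_mayerTermS_of_integralOps {Op : Finset LF → (Φ → ℂ) →+ (Φ → ℂ)}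
    {μ : Finset LF → Φ → Measure Φ} (hOp : IntegralOps Op μ) {V : Finset LF → DomY → Φ → ℂ} {a : Finset LF → DomY → ℝ}
    (hVm : ∀ S Y, Measurable (V S Y)) (hVb : ∀ S Y ψ, ‖V S Y ψ‖ ≤ a S Y) (φ : Φ) :
    mayerTermS191 Op V φ = mayerTermS Op V φ :=
  mayerTermS191_eq_mayerTermS_fun fun S _ =>
    exchange191_of_integralOps hOp (fun Y _ => hVm S Y) (fun Y _ ψ => hVb S Y ψ) φ S

/-- **(1.90) with the printed activities for integral operations** — `eq190_bracket191` with the exchange property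
DISCHARGED (`exchange191_of_integralOps`): measurable bounded `V(Y)`, integral operations.
[cite: Balaban1989LargeFieldII, (1.90) p.388] -/
theorem eq190_bracket191_of_integralOps {Cube : Type*} [DecidableEq Cube] {adjC : Cube → Cube → Prop}
    {locX : LF → Finset Cube} {locY : DomY → Finset Cube} {Yfix : Finset Cube}
    [Fintype LF] [Fintype DomY] [DecidableEq LF] [DecidableEq DomY] [DecidableRel adjC]
    (hrefl : ∀ a, adjC a a) (hsymm : ∀ a b, adjC a b → adjC b a) (houtX : ∀ j, (locX j \ Yfix).Nonempty)
    (houtY : ∀ Y, (locY Y \ Yfix).Nonempty) {Op : Finset LF → (Φ → ℂ) →+ (Φ → ℂ)}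
    {μ : Finset LF → Φ → Measure Φ} (hOp : IntegralOps Op μ) {V : DomY → Φ → ℂ} {a : DomY → ℝ}
    (hVm : ∀ Y, Measurable (V Y)) (hVb : ∀ Y ψ, ‖V Y ψ‖ ≤ a Y) (φ : Φ)
    (hOp0 : ∀ f, Op ∅ f = f) (hmul : TermMul adjC locX locY Yfix (mayerTerm191 Op V φ)) :
    bracket Op V φ = polymerPartitionFunction (pinc adjC Yfix) (F191 adjC locX locY Yfix (mayerTerm191 Op V φ))
      (polys190 adjC locX locY Yfix) :=
  eq190_bracket191 hrefl hsymm houtX houtY Op V φ hOp0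
    (fun S _ => exchange191_of_integralOps hOp (fun Y _ => hVm Y) (fun Y _ ψ => hVb Y ψ) φ S) hmul

/-- **(1.97), selector-free, for the printed activities and integral operations** — `norm_F191_mayerTerm191_le` with the
exchange property DISCHARGED by `exchange191_of_integralOps` (the (1.68)-type bound `h168` supplies the boundedness;
measurability of the `V(Y)` is the one extra hypothesis). [cite: Balaban1989LargeFieldII, (1.97) p.389] -/
theorem norm_F191_mayerTerm191_le_of_integralOps {Cube : Type*} [DecidableEq Cube] {adjC : Cube → Cube → Prop}
    {locX : LF → Finset Cube} {locY : DomY → Finset Cube} {Yfix : Finset Cube}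
    [Fintype LF] [Fintype DomY] [DecidableEq LF] [DecidableEq DomY]
    (sz : Sizes LF DomY Cube) (K : B16Ineq197.Consts) (hK : K.Small)
    {Op : Finset LF → (Φ → ℂ) →+ (Φ → ℂ)} {μ : Finset LF → Φ → Measure Φ} (hOpI : IntegralOps Op μ) {θ : LF → ℝ}
    (hOp : OpBound Op θ) (hθ : ∀ j, 0 ≤ θ j ∧ θ j ≤ K.θ)
    {V : DomY → Φ → ℂ} (hVm : ∀ Y, Measurable (V Y)) (h168 : ∀ Y ψ, ‖V Y ψ‖ ≤ K.a (sz.dY Y)) (φ : Φ)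
    {X : Finset Cube}
    (h193s : (polymer191 adjC locX locY Yfix sz X).Subadd193 K)
    (h193v : (polymer191 adjC locX locY Yfix sz X).Vol193 K)
    (hXB : (polymer191 adjC locX locY Yfix sz X).XBudget K)
    (h194 : (polymer191 adjC locX locY Yfix sz X).Anch194 K)
    (h196 : (polymer191 adjC locX locY Yfix sz X).Count196 K) :
    ‖F191 adjC locX locY Yfix (mayerTerm191 Op V φ) X‖
      ≤ (Real.exp (-K.p0) + K.α ^ (1 / 3 : ℝ)) * Real.exp (-((1 + K.β) * K.κ) * sz.dX X) :=
  norm_F191_mayerTerm191_le sz K hK hOp hθ h168 φ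
    (fun S _ => exchange191_of_integralOps hOpI (fun Y _ => hVm Y) (fun Y _ ψ => h168 Y ψ) φ S)
    h193s h193v hXB h194 h196

end Integral

/-! ## §5. Models: the evaluation operations `resetOp` of `B16Eq190Resummation` -/

section Models

variable {LF DomY Cube Var Sv : Type*} [DecidableEq Cube] {locX : LF → Finset Cube} {Yfix : Finset Cube}
  {site : Var → Cube}

/-- The evaluation operations `resetOp` (p24's non-identity model of `LocalOps`/`OpBound`) have the exchange property for
every term, with no hypothesis on `V` (evaluation commutes with every integral). [cite: Balaban1989LargeFieldII, (1.91) p.388] -/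
theorem exchange191_resetOp (ψ₀ : Var → Sv) (V : DomY → (Var → Sv) → ℂ) (φ : Var → Sv) (S : Finset LF)
    (D : Finset DomY) : Exchange191 (resetOp locX Yfix site ψ₀) V φ S D := rfl

/-- The evaluation operations ARE integral operations: against the Dirac measures at the reset configurations (for a
measurable space of configurations with measurable singletons). [cite: Balaban1989LargeFieldII, (1.71) p.378] -/
theorem integralOps_resetOp [MeasurableSpace (Var → Sv)] [MeasurableSingletonClass (Var → Sv)] (ψ₀ : Var → Sv) :
    IntegralOps (resetOp locX Yfix site ψ₀ : Finset LF → ((Var → Sv) → ℂ) →+ ((Var → Sv) → ℂ))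
      (fun S φ => Measure.dirac (resetCfg locX Yfix site S ψ₀ φ)) where
  isFiniteMeasure _ _ := inferInstance
  apply_eq S φ f _ := by
    rw [MeasureTheory.integral_dirac]
    rfl

/-- Joint non-vacuity: for the evaluation operations the printed summand and p24's Mayer term coincide outright.
[cite: Balaban1989LargeFieldII, (1.91) p.388] -/
theorem mayerTerm191_resetOp (ψ₀ : Var → Sv) (V : DomY → (Var → Sv) → ℂ) (φ : Var → Sv) :
    mayerTerm191 (resetOp locX Yfix site ψ₀ : Finset LF → ((Var → Sv) → ℂ) →+ ((Var → Sv) → ℂ)) V φ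
      = mayerTerm (resetOp locX Yfix site ψ₀) V φ :=
  mayerTerm191_eq fun S D => exchange191_resetOp ψ₀ V φ S D

end Models

end

end Literature.MathematicalPhysics.QuantumFieldTheory.Balaban1983to89.B16Eq191PrintedActivity
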